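/-
Copyright: the b2b-balaban T⁴-continuum CRUX team, row NE7b OWNER lineage `t4-ne7b-p1` (gen 140). Project licence.
-/
import Summits.QuantumFields.BalabanUV.T4Continuum.Spine.NE7b.SupWhitenedFourthMoment
import Summits.QuantumFields.BalabanUV.T4Continuum.Spine.NE7b.SupDobrushinThirdCumulant

/-!
# THE THIRD CUMULANT OF THREE GRADIENT COMPONENTS UNDER `N(0,AAᵀ)`, DISTINGUISHED FORM (SCOPING (d11)(4) — the instantiation of (461)):
# for the block class (`C²`, stability, gradient letter, `‖U″‖ ≤ κ₂`, secant letter `λ ≥ 0`, an entrywise Hessian majorant `Hk ≥ 0`) tilted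
# against `N(0,AAᵀ)` (ANY factor `A`, the road's operator letter with the regulator, the whitened regulator, `λγ_op < 1`), read in the
# whitened Gibbs format `ν ∝ e^{−V}dz` on `ℝ^κ` (`V(z) = ½z·z + U(A toLp z + ψ)`, observables `F_v(z) = U′(A toLp z + ψ)(e_v)` with vectors
# `a^v_w = Σ_u|A_{uw}|Hk_{vu}`), Dobrushin's smallness `Σ_{w≠x}HA_{xw} ≤ γ(1−lamA)` and ANY `D ≥ 0` with `I + D·C ≤ D`:
#   `|E_ν(F_x − E F_x)(F_y − E F_y)(F_z − E F_z)| ≤ 2√(2·(B(a^x,a^y) + B(a^x,a^z))·m₄)`,   `m₄ = 5κ₂⁴γ_op²∕(1−λγ_op)²`,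
# `B(a,b) = Σ_w (Dᵀa)_w(Dᵀb)_w∕(1−lamA)` — every hypothesis of (461) DISCHARGED from the class ((457)'s structural letters, (456)'s vectors,
# (458)'s moment letters, (465)'s fourth moments).  With (466)'s decay and (463)'s tree lemma this is the third-order kernel letter
# (successor) (row NE7b, node U5c; (456), (457), (458), (461), (465) BY NAME; [folklore])

Cell `pub-balaban`, sub-cell `t4`, spine estimate NE7b (`T4WeightBudget.RelWeightBound`; the cell's OWN estimate — NOT PRINTED in
[Bałaban 1983–89], NOT PROVED).  Crux-route work under `Spine/NE7b/` by the row OWNER (`t4-ne7b-p1` gen 140, file (467)) under FREEZE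
(0)'s crux-prover clause; NOTHING of Bałaban's is named as a Lean object, valued or asserted; no `T4Continuum/Support` leaf typed; no
`def`, no notation (everything WRITTEN OUT); zero `sorry`.  Imports (BY NAME): the OWNER's (465) `…SupWhitenedFourthMoment`
(`whitened_fourth_moment_gibbs`, `whitened_fourth_power_integrable`; through it (458), (457), (456)), (461) `…SupDobrushinThirdCumulant`
(`third_cumulant_le`).

WHAT IS PROVED ([folklore]): **`whitened_third_cumulant_raw`** (the display above).

HONEST (what this is NOT).  The `x`-distinguished form only (the `y`- and `z`-distinguished forms are the same theorem with the sites permuted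
and the integrand commuted); the decay of `B` and the tree sum are the successor's assembly; the cumulant FORM of `∂³W` for general `Γ`
((424)∕(425) are stated for `M⁻¹`) is NOT touched; orders four and five NOT typed.  Scalar skeleton ((A3), NC-NE7b-α UNRULED); nothing of
Bałaban's asserted.  BY-NAME EFFECT ON THE WALL: NONE.  NE7b NOT PRINTED ∕ NOT PROVED; spine PROVED 0∕9; rung (B)+1 — the programme's measures
remain FINITE-torus statements; NOT the mass gap, NOT Clay.  HONEST DEPENDENCY: continuum YM on T⁴ ⇐ BetaPertH ∧ nine spine estimates (0∕9
proved); BetaPertH ⇐ (D1) ∧ (D4) ∧ CAP+tail; G-an2-4 gates asym, D1 and NE2∕3∕4.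
-/

set_option autoImplicit false
set_option maxSynthPendingDepth 2

noncomputable section

namespace Summit.QuantumFields.BalabanUV.T4Continuum.NE7b.SupWhitenedThirdCumulantRaw

open MeasureTheory ProbabilityTheory Real Set Function Finset Matrix
open scoped BigOperators
open Literature.Probability.Distributions (matrixCLM)
open SupWhitenedFourthMoment (whitened_fourth_moment_gibbs whitened_fourth_power_integrable)
open SupWhitenedMomentLetters (whitened_exp_integrable whitened_second_moment_integrable)
open SupWhitenedCovarianceKernelLetter (whitenedV_hasDerivAt whitenedV_floor whitenedV_ceiling whitenedV_cross whitenedV_continuous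
  whitened_integrable_lebesgue)
open SupWhitenedFirstOrderLetters (whitened_obs_lipVec whitened_cross_nonneg)
open SupDobrushinThirdCumulant (third_cumulant_le)

variable {ι κ : Type} [Fintype ι] [DecidableEq ι] [Fintype κ] [DecidableEq κ]

variable {U : EuclideanSpace ℝ ι → ℝ} {U' : EuclideanSpace ℝ ι → EuclideanSpace ℝ ι →L[ℝ] ℝ}
  {U'' : EuclideanSpace ℝ ι → EuclideanSpace ℝ ι →L[ℝ] EuclideanSpace ℝ ι →L[ℝ] ℝ} {Hk : ι → ι → ℝ} {A : Matrix ι κ ℝ}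
  {ψ : EuclideanSpace ℝ ι} {γop κ₀ κ₁ κ₂ a τ δ θ lam lamA γ : ℝ} {D : κ → κ → ℝ}

/-- **THE THIRD CUMULANT OF THREE GRADIENT COMPONENTS, `x`-DISTINGUISHED, EVERY LETTER DISCHARGED**:
`|∫(F_x − E F_x)(F_y − E F_y)(F_z − E F_z)dν| ≤ 2√(2·Σ_w (Dᵀa^x)_w((Dᵀa^y)_w + (Dᵀa^z)_w)∕(1−lamA) · 5κ₂⁴γ_op²∕(1−λγ_op)²)`. [folklore] -/
theorem whitened_third_cumulant_raw [Nonempty κ] (hΓop : (γop • (1 : Matrix ι ι ℝ) - A * Aᵀ).PosSemidef) (Y : Finset ι)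
    (hUd : ∀ φ : EuclideanSpace ℝ ι, HasFDerivAt U (U' φ) φ) (hU'd : ∀ φ : EuclideanSpace ℝ ι, HasFDerivAt U' (U'' φ) φ)
    (hU''c : Continuous U'') (hκ₀ : 0 ≤ κ₀) (hκ₁ : 0 ≤ κ₁) (ha : 0 ≤ a) (hτ : 0 < τ) (hδ : 0 < δ) (hθ0 : 0 < θ) (hθ1 : θ < 1)
    (hκθ : (2 * κ₀ * (1 + τ) + 4 * δ) * γop ≤ θ) (hκθw : 2 * κ₀ * (1 + τ) * γop + 4 * δ ≤ θ)
    (hstab : ∀ φ : EuclideanSpace ℝ ι, -(κ₀ * ∑ x ∈ Y, φ x ^ 2) ≤ U φ)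
    (hU'b : ∀ φ : EuclideanSpace ℝ ι, ‖U' φ‖ ≤ κ₁ * (a + ∑ x ∈ Y, φ x ^ 2)) (hU''b : ∀ φ : EuclideanSpace ℝ ι, ‖U'' φ‖ ≤ κ₂) (hlam : 0 ≤ lam)
    (hUsec : ∀ s : ℝ, 0 ≤ s → s ≤ 1 → ∀ a b : EuclideanSpace ℝ ι,
      U ((1 - s) • a + s • b) - lam / 2 * (s * (1 - s)) * ∑ i, (a i - b i) ^ 2 ≤ (1 - s) * U a + s * U b)
    (hρ : lam * γop < 1)
    (hHk : ∀ (φ : EuclideanSpace ℝ ι) (x z : ι), |U'' φ (EuclideanSpace.single z (1 : ℝ)) (EuclideanSpace.single x (1 : ℝ))| ≤ Hk x z)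
    (hHk0 : ∀ v u, 0 ≤ Hk v u) (ψ : EuclideanSpace ℝ ι) (hlamA : ∀ x : κ, ∑ u, ∑ v, |A u x| * |A v x| * Hk v u ≤ lamA) (hlamA1 : lamA < 1)
    (hrow : ∀ x : κ, ∑ w, (if w = x then 0 else ∑ u, ∑ v, |A u w| * |A v x| * Hk v u) / (1 - lamA) ≤ γ) (hγ0 : 0 ≤ γ) (hγ1 : γ < 1)
    (hD : ∀ x y, 0 ≤ D x y)
    (hDC : ∀ x y, (if x = y then (1 : ℝ) else 0) + ∑ z, D x z * ((if y = z then 0 else ∑ u, ∑ v, |A u y| * |A v z| * Hk v u) / (1 - lamA)) ≤ D x y)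
    (x y z : ι) :
    |∫ w, (U' (matrixCLM A (WithLp.toLp 2 w) + ψ) (EuclideanSpace.single x (1 : ℝ)) -
            ∫ w', U' (matrixCLM A (WithLp.toLp 2 w') + ψ) (EuclideanSpace.single x (1 : ℝ))
              ∂((volume : Measure (κ → ℝ)).tilted fun z => -(1 / 2 * (z ⬝ᵥ z) + U (matrixCLM A (WithLp.toLp 2 z) + ψ)))) *
          (U' (matrixCLM A (WithLp.toLp 2 w) + ψ) (EuclideanSpace.single y (1 : ℝ)) -
            ∫ w', U' (matrixCLM A (WithLp.toLp 2 w') + ψ) (EuclideanSpace.single y (1 : ℝ))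
              ∂((volume : Measure (κ → ℝ)).tilted fun z => -(1 / 2 * (z ⬝ᵥ z) + U (matrixCLM A (WithLp.toLp 2 z) + ψ)))) *
          (U' (matrixCLM A (WithLp.toLp 2 w) + ψ) (EuclideanSpace.single z (1 : ℝ)) -
            ∫ w', U' (matrixCLM A (WithLp.toLp 2 w') + ψ) (EuclideanSpace.single z (1 : ℝ))
              ∂((volume : Measure (κ → ℝ)).tilted fun z => -(1 / 2 * (z ⬝ᵥ z) + U (matrixCLM A (WithLp.toLp 2 z) + ψ))))
        ∂((volume : Measure (κ → ℝ)).tilted fun z => -(1 / 2 * (z ⬝ᵥ z) + U (matrixCLM A (WithLp.toLp 2 z) + ψ)))| ≤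
      2 * Real.sqrt (2 * (∑ w, (∑ z', D z' w * ∑ u, |A u z'| * Hk x u) * ((∑ z', D z' w * ∑ u, |A u z'| * Hk y u) +
        ∑ z', D z' w * ∑ u, |A u z'| * Hk z u) / (1 - lamA)) * (5 * (κ₂ ^ 4 * γop ^ 2) / (1 - lam * γop) ^ 2)) := by
  haveI : Nonempty ι := ⟨x⟩
  have hUc : Continuous U := continuous_iff_continuousAt.2 fun φ => (hUd φ).continuousAt
  have hcpos : ∀ _x : κ, 0 < 1 - lamA := fun _ => by linarith
  have hκθ₀ : 2 * κ₀ * (1 + τ) * γop ≤ θ := SupEffectiveActionDerivative.mul_opBound_le_of_le (by positivity) (by linarith) hθ0.le hκθ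
  -- the moment letters of (447) in Lebesgue form ((458) through (457)'s bridge)
  have hI0 := whitened_exp_integrable hΓop Y hUc.measurable hκ₀ hτ hθ1 hκθ₀ hstab ψ
  have hI2 := fun w => whitened_second_moment_integrable hΓop Y hUc.measurable hκ₀ hτ hδ hθ1 hκθw hstab ψ w
  have hV0 : Integrable (fun z : κ → ℝ => exp (-(1 / 2 * (z ⬝ᵥ z) + U (matrixCLM A (WithLp.toLp 2 z) + ψ)))) := by
    have h := whitened_integrable_lebesgue A ψ (k := fun _ => (1 : ℝ)) (by simpa only [mul_one] using hI0)
    simpa only [one_mul] using h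
  have hV2 : ∀ w, Integrable (fun z : κ → ℝ => z w ^ 2 * exp (-(1 / 2 * (z ⬝ᵥ z) + U (matrixCLM A (WithLp.toLp 2 z) + ψ)))) := fun w => by
    have h := whitened_integrable_lebesgue A ψ (k := fun ξ : EuclideanSpace ℝ κ => ξ w ^ 2) (hI2 w)
    simpa only [PiLp.toLp_apply] using h
  have hJ : ∀ x w : κ, 0 ≤ (if w = x then (0 : ℝ) else ∑ u, ∑ v, |A u w| * |A v x| * Hk v u) := fun x w => by
    split_ifs
    · exact le_rfl
    · exact whitened_cross_nonneg hHk0 A x w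
  have hrow' : ∀ x : κ, ∑ w, (if w = x then (0 : ℝ) else ∑ u, ∑ v, |A u w| * |A v x| * Hk v u) / (1 - lamA) ≤ γ := hrow
  -- the fourth centred moments ((465))
  have h4 := fun v => whitened_fourth_moment_gibbs hΓop Y hUd hU'd hU''c hκ₀ hκ₁ ha hτ hδ hθ0 hθ1 hκθ hstab hU'b hU''b hlam hUsec hρ ψ v
  have hI4 := fun v c => whitened_fourth_power_integrable hΓop Y hUd hU'd hκ₀ hκ₁ ha hτ hδ hθ0 hθ1 hκθ hstab hU'b ψ v c
  -- (461) with everything written out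
  exact third_cumulant_le
    (P := fun x F ω => (∫ s, F (update ω x s) * exp (-(1 / 2 * (update ω x s ⬝ᵥ update ω x s) + U (matrixCLM A (WithLp.toLp 2 (update ω x s)) + ψ)))) /
      ∫ s, exp (-(1 / 2 * (update ω x s ⬝ᵥ update ω x s) + U (matrixCLM A (WithLp.toLp 2 (update ω x s)) + ψ))))
    (V := fun z => 1 / 2 * (z ⬝ᵥ z) + U (matrixCLM A (WithLp.toLp 2 z) + ψ))
    (V₁ := fun x z => z x + U' (matrixCLM A (WithLp.toLp 2 z) + ψ) (matrixCLM A (EuclideanSpace.single x (1 : ℝ))))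
    (c := fun _ => 1 - lamA) (Cw := 1 + lamA) (J := fun x w => if w = x then 0 else ∑ u, ∑ v, |A u w| * |A v x| * Hk v u) (γ := γ) (D := D)
    (F := fun w => U' (matrixCLM A (WithLp.toLp 2 w) + ψ) (EuclideanSpace.single x (1 : ℝ)))
    (G := fun w => U' (matrixCLM A (WithLp.toLp 2 w) + ψ) (EuclideanSpace.single y (1 : ℝ)))
    (H := fun w => U' (matrixCLM A (WithLp.toLp 2 w) + ψ) (EuclideanSpace.single z (1 : ℝ)))
    (a := fun w => ∑ u, |A u w| * Hk x u) (b := fun w => ∑ u, |A u w| * Hk y u) (h := fun w => ∑ u, |A u w| * Hk z u)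
    (fun _ _ _ => rfl) (fun x z => whitenedV_hasDerivAt hUd A ψ x z) (fun x z s t => whitenedV_floor hU'd hHk A hlamA ψ x z s t) hcpos
    (fun x z s t => whitenedV_ceiling hU'd hHk A hlamA ψ x z s t)
    (fun x w hw z s t => by rw [if_neg hw]; exact whitenedV_cross hU'd hHk A ψ x w hw z s t)
    (whitenedV_continuous hUd A ψ) hV0 hV2 hJ (fun x => by simp) hrow' hγ0 hγ1 hD hDC
    (fun w z s t => whitened_obs_lipVec hU'd hHk A ψ x w z s t) (fun w z s t => whitened_obs_lipVec hU'd hHk A ψ y w z s t)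
    (fun w z' s t => whitened_obs_lipVec hU'd hHk A ψ z w z' s t) _ _ (hI4 x _) (hI4 y _) (hI4 z _) (h4 x) (h4 y) (h4 z)

end Summit.QuantumFields.BalabanUV.T4Continuum.NE7b.SupWhitenedThirdCumulantRaw

end
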